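import Summits.CriticalPhenomena.PercolationContinuityZ3.Theses.PercNearOneGluing
import Literature.Probability.Percolation.PercolationEvents
import Literature.Probability.LatticeModels.ProdBernoulliIndependence
import Literature.Probability.LatticeModels.ProdBernoulliCoupling
import HarnessLib.Audit

/-! TTRL-lite variant V2380 of stmt-CriticalPhenomena-4574 -/

namespace Summit.CriticalPhenomena.PercolationContinuityZ3.Theorems

open MeasureTheory Set Literature.Probability.LatticeModels Literature.Probability.Percolation
open scoped Classical BigOperators

variable {n : ℕ}

/-- An open pair joins its endpoints. -/
theorem v2380_reach_of_mem {ω : Set (Sym2 (Fin n))} {a b : Fin n} (h : s(a, b) ∈ ω) :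
    (openGraph ω).Reachable a b := by
  by_cases hab : a = b
  · subst hab; exact SimpleGraph.Reachable.refl a
  · exact SimpleGraph.Adj.reachable ((openGraph_adj ω a b).2 ⟨h, hab⟩)

/-- Symmetry of pair membership. -/
theorem v2380_mem_swap {ω : Set (Sym2 (Fin n))} {a b : Fin n} (h : s(a, b) ∈ ω) :
    s(b, a) ∈ ω := by
  rw [Sym2.eq_swap]; exact h

/-- First step of an open path between distinct vertices. -/
theorem v2380_step {ω : Set (Sym2 (Fin n))} {a b : Fin n} (h : (openGraph ω).Reachable a b)
    (hab : a ≠ b) : ∃ c, s(a, c) ∈ ω ∧ a ≠ c ∧ (openGraph ω).Reachable c b := by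
  rw [SimpleGraph.reachable_iff_reflTransGen] at h
  rcases h.cases_head with h | ⟨c, hac, hcb⟩
  · exact absurd h hab
  · exact ⟨c, ((openGraph_adj ω a c).1 hac).1, ((openGraph_adj ω a c).1 hac).2,
      (SimpleGraph.reachable_iff_reflTransGen c b).2 hcb⟩

/-- `{a ↔ a}` is the sure event. -/
theorem v2380_openConn_self (a : Fin n) : (openConn a a : Set (Set (Sym2 (Fin n)))) = Set.univ :=
  Set.eq_univ_of_forall fun ω => show (openGraph ω).Reachable a a from SimpleGraph.Reachable.refl a

/-- Distinct unordered pairs. -/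
theorem v2380_ne_sym2 {a b c d : Fin n} (h1 : a ≠ c ∨ b ≠ d) (h2 : a ≠ d ∨ b ≠ c) :
    s(a, b) ≠ s(c, d) := by
  rw [Ne, Sym2.eq_iff]; tauto

/-- Four distinct vertices exhaust `Fin n` when `n ≤ 4`. -/
theorem v2380_cover (hn : n ≤ 4) {v x p q : Fin n} (hvx : v ≠ x) (hvp : v ≠ p) (hvq : v ≠ q)
    (hxp : x ≠ p) (hxq : x ≠ q) (hpq : p ≠ q) (y : Fin n) : y = v ∨ y = x ∨ y = p ∨ y = q := by
  simp only [ne_eq, Fin.ext_iff] at hvx hvp hvq hxp hxq hpq ⊢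
  have := v.isLt; have := x.isLt; have := p.isLt; have := q.isLt; have := y.isLt
  omega

/-- Bounding a probability by another up to a null event. -/
theorem v2380_le_of_null {μ : Measure (Set (Sym2 (Fin n)))} [IsFiniteMeasure μ]
    {S T N : Set (Set (Sym2 (Fin n)))} (hN : μ.real N = 0) (h : S ⊆ T ∪ N) :
    μ.real S ≤ μ.real T :=
  calc μ.real S ≤ μ.real (T ∪ N) := measureReal_mono h
    _ ≤ μ.real T + μ.real N := measureReal_union_le T N
    _ = μ.real T := by rw [hN, add_zero]

/-- `U Z ≤ R` from `Z ≤ R` for a sub-probability factor `U`. -/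
theorem v2380_mul_le_of_right {U Z R : ℝ} (hU1 : U ≤ 1) (hZ0 : 0 ≤ Z) (h : Z ≤ R) :
    U * Z ≤ R := by nlinarith [mul_nonneg (sub_nonneg.2 hU1) hZ0, h]

/-- `U Z ≤ R` from `U ≤ R` for a sub-probability factor `Z`. -/
theorem v2380_mul_le_of_left {U Z R : ℝ} (hU0 : 0 ≤ U) (hZ1 : Z ≤ 1) (h : U ≤ R) :
    U * Z ≤ R := by nlinarith [mul_nonneg hU0 (sub_nonneg.2 hZ1), h]

/-- Raising one weight to `1` increases the weight function. -/
theorem v2380_le_update (w : Sym2 (Fin n) → unitInterval) (e₀ : Sym2 (Fin n)) :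
    w ≤ Function.update w e₀ 1 := by
  intro e
  by_cases he : e = e₀
  · subst he; rw [Function.update_self]; exact unitInterval.le_one'
  · rw [Function.update_of_ne he]

/-- One-pair peeling: an event not looking at the pair `e` is independent of the state of `e`. -/
theorem v2380_peel (u : Sym2 (Fin n) → unitInterval) (e : Sym2 (Fin n))
    {B : Set (Set (Sym2 (Fin n)))}
    (hB : ∀ ω ω' : Set (Sym2 (Fin n)), (∀ i, i ≠ e → (i ∈ ω ↔ i ∈ ω')) → (ω ∈ B ↔ ω' ∈ B)) :
    (prodBernoulli u).real ({ω | e ∈ ω} ∩ B) = (u e : ℝ) * (prodBernoulli u).real B ∧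
    (prodBernoulli u).real ({ω | e ∉ ω} ∩ B) = (1 - (u e : ℝ)) * (prodBernoulli u).real B := by
  have he : e ∈ ((↑({e} : Finset (Sym2 (Fin n)))) : Set (Sym2 (Fin n))) := by rw [Finset.coe_singleton]; rfl
  have hBd : DeterminedBy B ((↑({e} : Finset (Sym2 (Fin n))) : Set (Sym2 (Fin n)))ᶜ) := by
    rw [determinedBy_iff]
    intro ω ω' h
    refine hB ω ω' fun i hi => ?_
    have hi' : i ∈ ((↑({e} : Finset (Sym2 (Fin n))) : Set (Sym2 (Fin n)))ᶜ) := by rw [Finset.coe_singleton]; exact hi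
    exact ⟨fun hω => ((Set.ext_iff.1 h i).1 ⟨hω, hi'⟩).1, fun hω' => ((Set.ext_iff.1 h i).2 ⟨hω', hi'⟩).1⟩
  have hA : ∀ ω ω' : Set (Sym2 (Fin n)), ω ∩ ((↑({e} : Finset (Sym2 (Fin n)))) : Set (Sym2 (Fin n)))
      = ω' ∩ ((↑({e} : Finset (Sym2 (Fin n)))) : Set (Sym2 (Fin n))) → (e ∈ ω ↔ e ∈ ω') :=
    fun ω ω' h => ⟨fun hω => ((Set.ext_iff.1 h e).1 ⟨hω, he⟩).1, fun hω' => ((Set.ext_iff.1 h e).2 ⟨hω', he⟩).1⟩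
  have hA1 : DeterminedBy {ω : Set (Sym2 (Fin n)) | e ∈ ω} ((↑({e} : Finset (Sym2 (Fin n)))) : Set _) := by
    rw [determinedBy_iff]; exact fun ω ω' h => hA ω ω' h
  have hA2 : DeterminedBy {ω : Set (Sym2 (Fin n)) | e ∉ ω} ((↑({e} : Finset (Sym2 (Fin n)))) : Set _) := by
    rw [determinedBy_iff]; exact fun ω ω' h => not_congr (hA ω ω' h)
  refine ⟨?_, ?_⟩
  · rw [prodBernoulli_real_inter_of_determinedBy u {e} hA1 hBd MeasurableSet.of_discrete
      MeasurableSet.of_discrete, prodBernoulli_real_setOf_mem]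
  · rw [prodBernoulli_real_inter_of_determinedBy u {e} hA2 hBd MeasurableSet.of_discrete
      MeasurableSet.of_discrete, prodBernoulli_real_setOf_notMem]

/-- Complement rule for `prodBernoulli` on a finite index set. -/
theorem v2380_compl (u : Sym2 (Fin n) → unitInterval) (S : Set (Set (Sym2 (Fin n)))) :
    (prodBernoulli u).real Sᶜ = 1 - (prodBernoulli u).real S :=
  probReal_compl_eq_one_sub MeasurableSet.of_discrete

/-- The four cylinder probabilities on the five free pairs of the generic four-vertex case. -/
theorem v2380_cyl (u : Sym2 (Fin n) → unitInterval) {v x p q : Fin n}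
    (hvx : v ≠ x) (hvp : v ≠ p) (hvq : v ≠ q) (hxp : x ≠ p) (hxq : x ≠ q) (hpq : p ≠ q) :
    (prodBernoulli u).real ({ω | s(p, q) ∈ ω} ∩ ({ω | s(v, p) ∉ ω} ∩ ({ω | s(x, p) ∉ ω} ∩
        ({ω | s(v, q) ∉ ω} ∩ {ω | s(x, q) ∉ ω})))) =
      (u s(p, q) : ℝ) * ((1 - u s(v, p)) * ((1 - u s(x, p)) * ((1 - u s(v, q)) * (1 - u s(x, q))))) ∧
    (prodBernoulli u).real ({ω | s(p, q) ∉ ω} ∩ ({ω | s(v, p) ∉ ω} ∩ ({ω | s(x, p) ∉ ω} ∩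
        ({ω | s(v, q) ∉ ω} ∩ {ω | s(x, q) ∉ ω})ᶜ))) =
      (1 - u s(p, q) : ℝ) * ((1 - u s(v, p)) * ((1 - u s(x, p)) * (1 - (1 - u s(v, q)) * (1 - u s(x, q))))) ∧
    (prodBernoulli u).real ({ω | s(x, q) ∈ ω} ∩ ({ω | s(x, p) ∉ ω} ∩ ({ω | s(p, q) ∉ ω} ∩
        ({ω | s(v, p) ∈ ω} ∩ {ω | s(v, q) ∈ ω})ᶜ))) =
      (u s(x, q) : ℝ) * ((1 - u s(x, p)) * ((1 - u s(p, q)) * (1 - u s(v, p) * u s(v, q)))) ∧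
    (prodBernoulli u).real ({ω | s(x, p) ∉ ω} ∩ ({ω | s(x, q) ∉ ω} ∩
        ({ω | s(p, q) ∉ ω} ∩ ({ω | s(v, p) ∈ ω} ∩ {ω | s(v, q) ∈ ω})ᶜ)ᶜ)) =
      (1 - u s(x, p) : ℝ) * ((1 - u s(x, q)) * (1 - (1 - u s(p, q)) * (1 - u s(v, p) * u s(v, q)))) := by
  have nVP_PQ : s(v, p) ≠ s(p, q) := v2380_ne_sym2 (Or.inl hvp) (Or.inl hvq)
  have nXP_PQ : s(x, p) ≠ s(p, q) := v2380_ne_sym2 (Or.inl hxp) (Or.inl hxq)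
  have nVQ_PQ : s(v, q) ≠ s(p, q) := v2380_ne_sym2 (Or.inl hvp) (Or.inl hvq)
  have nXQ_PQ : s(x, q) ≠ s(p, q) := v2380_ne_sym2 (Or.inl hxp) (Or.inl hxq)
  have nXP_VP : s(x, p) ≠ s(v, p) := v2380_ne_sym2 (Or.inl hvx.symm) (Or.inl hxp)
  have nVQ_VP : s(v, q) ≠ s(v, p) := v2380_ne_sym2 (Or.inr hpq.symm) (Or.inl hvp)
  have nXQ_VP : s(x, q) ≠ s(v, p) := v2380_ne_sym2 (Or.inl hvx.symm) (Or.inl hxp)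
  have nVQ_XP : s(v, q) ≠ s(x, p) := v2380_ne_sym2 (Or.inl hvx) (Or.inl hvp)
  have nXQ_XP : s(x, q) ≠ s(x, p) := v2380_ne_sym2 (Or.inr hpq.symm) (Or.inl hxp)
  have nXQ_VQ : s(x, q) ≠ s(v, q) := v2380_ne_sym2 (Or.inl hvx.symm) (Or.inl hxq)
  refine ⟨?_, ?_, ?_, ?_⟩
  · rw [(v2380_peel u s(p, q) fun ω ω' h => by
      simp only [Set.mem_inter_iff, Set.mem_setOf_eq, h _ nVP_PQ, h _ nXP_PQ, h _ nVQ_PQ, h _ nXQ_PQ]).1,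
      (v2380_peel u s(v, p) fun ω ω' h => by
      simp only [Set.mem_inter_iff, Set.mem_setOf_eq, h _ nXP_VP, h _ nVQ_VP, h _ nXQ_VP]).2,
      (v2380_peel u s(x, p) fun ω ω' h => by
      simp only [Set.mem_inter_iff, Set.mem_setOf_eq, h _ nVQ_XP, h _ nXQ_XP]).2,
      (v2380_peel u s(v, q) fun ω ω' h => by simp only [Set.mem_setOf_eq, h _ nXQ_VQ]).2,
      prodBernoulli_real_setOf_notMem]
  · rw [(v2380_peel u s(p, q) fun ω ω' h => by simp only [Set.mem_inter_iff, Set.mem_setOf_eq,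
        Set.mem_compl_iff, h _ nVP_PQ, h _ nXP_PQ, h _ nVQ_PQ, h _ nXQ_PQ]).2,
      (v2380_peel u s(v, p) fun ω ω' h => by simp only [Set.mem_inter_iff, Set.mem_setOf_eq,
        Set.mem_compl_iff, h _ nXP_VP, h _ nVQ_VP, h _ nXQ_VP]).2,
      (v2380_peel u s(x, p) fun ω ω' h => by
      simp only [Set.mem_inter_iff, Set.mem_setOf_eq, Set.mem_compl_iff, h _ nVQ_XP, h _ nXQ_XP]).2,
      v2380_compl,
      (v2380_peel u s(v, q) fun ω ω' h => by simp only [Set.mem_setOf_eq, h _ nXQ_VQ]).2,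
      prodBernoulli_real_setOf_notMem]
  · rw [(v2380_peel u s(x, q) fun ω ω' h => by simp only [Set.mem_inter_iff, Set.mem_setOf_eq,
        Set.mem_compl_iff, h _ nXQ_XP.symm, h _ nXQ_PQ.symm, h _ nXQ_VP.symm, h _ nXQ_VQ.symm]).1,
      (v2380_peel u s(x, p) fun ω ω' h => by simp only [Set.mem_inter_iff, Set.mem_setOf_eq,
        Set.mem_compl_iff, h _ nXP_PQ.symm, h _ nXP_VP.symm, h _ nVQ_XP]).2,
      (v2380_peel u s(p, q) fun ω ω' h => by
      simp only [Set.mem_inter_iff, Set.mem_setOf_eq, Set.mem_compl_iff, h _ nVP_PQ, h _ nVQ_PQ]).2,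
      v2380_compl,
      (v2380_peel u s(v, p) fun ω ω' h => by simp only [Set.mem_setOf_eq, h _ nVQ_VP]).1,
      prodBernoulli_real_setOf_mem]
  · rw [(v2380_peel u s(x, p) fun ω ω' h => by simp only [Set.mem_inter_iff, Set.mem_setOf_eq,
        Set.mem_compl_iff, h _ nXQ_XP, h _ nXP_PQ.symm, h _ nXP_VP.symm, h _ nVQ_XP]).2,
      (v2380_peel u s(x, q) fun ω ω' h => by simp only [Set.mem_inter_iff, Set.mem_setOf_eq,
        Set.mem_compl_iff, h _ nXQ_PQ.symm, h _ nXQ_VP.symm, h _ nXQ_VQ.symm]).2,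
      v2380_compl,
      (v2380_peel u s(p, q) fun ω ω' h => by
      simp only [Set.mem_inter_iff, Set.mem_setOf_eq, Set.mem_compl_iff, h _ nVP_PQ, h _ nVQ_PQ]).2,
      v2380_compl,
      (v2380_peel u s(v, p) fun ω ω' h => by simp only [Set.mem_setOf_eq, h _ nVQ_VP]).1,
      prodBernoulli_real_setOf_mem]

/-- Inclusions 1–2 (glued pair open): `{p ↔ q} ∖ {v ↔ q} ⊆ C1` and `C2 ⊆ {v ↔ q} ∖ {p ↔ q}` a.s. -/
theorem v2380_I12 {v x p q : Fin n} (hpq : p ≠ q)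
    (cover : ∀ y : Fin n, y = v ∨ y = x ∨ y = p ∨ y = q) :
    (openConn p q \ openConn v q : Set (Set (Sym2 (Fin n)))) ⊆
      ({ω | s(p, q) ∈ ω} ∩ ({ω | s(v, p) ∉ ω} ∩ ({ω | s(x, p) ∉ ω} ∩
        ({ω | s(v, q) ∉ ω} ∩ {ω | s(x, q) ∉ ω})))) ∪ {ω | s(v, x) ∉ ω} ∧
    ({ω | s(p, q) ∉ ω} ∩ ({ω | s(v, p) ∉ ω} ∩ ({ω | s(x, p) ∉ ω} ∩
        ({ω | s(v, q) ∉ ω} ∩ {ω | s(x, q) ∉ ω})ᶜ)) : Set (Set (Sym2 (Fin n)))) ⊆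
      (openConn v q \ openConn p q) ∪ {ω | s(v, x) ∉ ω} := by
  refine ⟨fun ω hω => ?_, fun ω hω => ?_⟩
  · have hpq' : (openGraph ω).Reachable p q := hω.1
    have hvq' : ¬ (openGraph ω).Reachable v q := hω.2
    refine (em (s(v, x) ∈ ω)).elim (fun hvxω => Or.inl ?_) fun hvxω => Or.inr hvxω
    have rvx : (openGraph ω).Reachable v x := v2380_reach_of_mem hvxω
    have h_vp : s(v, p) ∉ ω := fun h => hvq' ((v2380_reach_of_mem h).trans hpq')
    have h_xp : s(x, p) ∉ ω := fun h => hvq' (rvx.trans ((v2380_reach_of_mem h).trans hpq'))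
    refine ⟨?_, h_vp, h_xp, fun h => hvq' (v2380_reach_of_mem h),
      fun h => hvq' (rvx.trans (v2380_reach_of_mem h))⟩
    obtain ⟨c, hc, hpc, -⟩ := v2380_step hpq' hpq
    rcases cover c with rfl | rfl | rfl | rfl
    · exact absurd (v2380_mem_swap hc) h_vp
    · exact absurd (v2380_mem_swap hc) h_xp
    · exact absurd rfl hpc
    · exact hc
  · have h_pq : s(p, q) ∉ ω := hω.1
    have h_vp : s(v, p) ∉ ω := hω.2.1
    have h_xp : s(x, p) ∉ ω := hω.2.2.1
    have h_or : ω ∉ ({ω | s(v, q) ∉ ω} ∩ {ω | s(x, q) ∉ ω} : Set (Set (Sym2 (Fin n)))) := hω.2.2.2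
    refine (em (s(v, x) ∈ ω)).elim (fun hvxω => Or.inl ⟨?_, ?_⟩) fun hvxω => Or.inr hvxω
    · show (openGraph ω).Reachable v q
      by_contra hvq
      exact h_or ⟨fun h => hvq (v2380_reach_of_mem h),
        fun h => hvq ((v2380_reach_of_mem hvxω).trans (v2380_reach_of_mem h))⟩
    · show ¬ (openGraph ω).Reachable p q
      intro hr
      obtain ⟨c, hc, hpc, -⟩ := v2380_step hr hpq
      rcases cover c with rfl | rfl | rfl | rfl
      · exact h_vp (v2380_mem_swap hc)
      · exact h_xp (v2380_mem_swap hc)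
      · exact hpc rfl
      · exact h_pq hc

/-- Inclusions 3–4 (glued pair closed): `{x ↔ q} ∖ {p ↔ q} ⊆ C3` and `C4 ⊆ {p ↔ q} ∖ {x ↔ q}` a.s. -/
theorem v2380_I34 {v x p q : Fin n} (hxq : x ≠ q)
    (cover : ∀ y : Fin n, y = v ∨ y = x ∨ y = p ∨ y = q) :
    (openConn x q \ openConn p q : Set (Set (Sym2 (Fin n)))) ⊆
      ({ω | s(x, q) ∈ ω} ∩ ({ω | s(x, p) ∉ ω} ∩ ({ω | s(p, q) ∉ ω} ∩
        ({ω | s(v, p) ∈ ω} ∩ {ω | s(v, q) ∈ ω})ᶜ))) ∪ {ω | s(v, x) ∈ ω} ∧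
    ({ω | s(x, p) ∉ ω} ∩ ({ω | s(x, q) ∉ ω} ∩
        ({ω | s(p, q) ∉ ω} ∩ ({ω | s(v, p) ∈ ω} ∩ {ω | s(v, q) ∈ ω})ᶜ)ᶜ) : Set (Set (Sym2 (Fin n)))) ⊆
      (openConn p q \ openConn x q) ∪ {ω | s(v, x) ∈ ω} := by
  refine ⟨fun ω hω => ?_, fun ω hω => ?_⟩
  · have hxq' : (openGraph ω).Reachable x q := hω.1
    have hpq' : ¬ (openGraph ω).Reachable p q := hω.2
    refine (em (s(v, x) ∈ ω)).elim (fun hvxω => Or.inr hvxω) fun hvxω => Or.inl ?_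
    have h_xp : s(x, p) ∉ ω := fun h => hpq' ((v2380_reach_of_mem (v2380_mem_swap h)).trans hxq')
    refine ⟨?_, h_xp, fun h => hpq' (v2380_reach_of_mem h), fun h =>
      hpq' ((v2380_reach_of_mem (v2380_mem_swap h.1)).trans (v2380_reach_of_mem h.2))⟩
    obtain ⟨c, hc, hxc, -⟩ := v2380_step hxq' hxq
    rcases cover c with rfl | rfl | rfl | rfl
    · exact absurd (v2380_mem_swap hc) hvxω
    · exact absurd rfl hxc
    · exact absurd hc h_xp
    · exact hc
  · have h_xp : s(x, p) ∉ ω := hω.1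
    have h_xq : s(x, q) ∉ ω := hω.2.1
    have h_G : ω ∉ ({ω | s(p, q) ∉ ω} ∩ ({ω | s(v, p) ∈ ω} ∩ {ω | s(v, q) ∈ ω})ᶜ :
        Set (Set (Sym2 (Fin n)))) := hω.2.2
    refine (em (s(v, x) ∈ ω)).elim (fun hvxω => Or.inr hvxω) fun hvxω => Or.inl ⟨?_, ?_⟩
    · show (openGraph ω).Reachable p q
      by_contra hr
      exact h_G ⟨fun h => hr (v2380_reach_of_mem h), fun h =>
        hr ((v2380_reach_of_mem (v2380_mem_swap h.1)).trans (v2380_reach_of_mem h.2))⟩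
    · show ¬ (openGraph ω).Reachable x q
      intro hr
      obtain ⟨c, hc, hxc, -⟩ := v2380_step hr hxq
      rcases cover c with rfl | rfl | rfl | rfl
      · exact hvxω (v2380_mem_swap hc)
      · exact hxc rfl
      · exact h_xp hc
      · exact h_xq hc

/-- The generic four-vertex case (`x ∈ A`, relay `p = a₀ ∉ {v, x, b}`, target `q = b`): minimality
of `p` before gluing gives `P(p ↔ q) ≤ P(v ↔ q)` after gluing `x` onto `v`.  With `a, c, d, e, f` the
weights of `vp, vq, xp, xq, pq`: `F2 - F1 = (1-a)(F3 - F4) + (1-a)(1-d)((1-f)ac + (1-e)c) ≥ 0`. -/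
theorem v2380_hard (w : Sym2 (Fin n) → unitInterval) {v x p q : Fin n}
    (hvx : v ≠ x) (hvp : v ≠ p) (hvq : v ≠ q) (hxp : x ≠ p) (hxq : x ≠ q) (hpq : p ≠ q)
    (cover : ∀ y : Fin n, y = v ∨ y = x ∨ y = p ∨ y = q) (hw0 : w s(v, x) = 0)
    (hmin : (prodBernoulli w).real (openConn p q) ≤ (prodBernoulli w).real (openConn x q)) :
    (prodBernoulli (Function.update w s(v, x) 1)).real (openConn p q) ≤
      (prodBernoulli (Function.update w s(v, x) 1)).real (openConn v q) := by
  obtain ⟨hF1, hF2, -, -⟩ := v2380_cyl (Function.update w s(v, x) 1) hvx hvp hvq hxp hxq hpq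
  obtain ⟨-, -, hF3, hF4⟩ := v2380_cyl w hvx hvp hvq hxp hxq hpq
  have hu : ∀ e, e ≠ s(v, x) → Function.update w s(v, x) 1 e = w e := fun e he => Function.update_of_ne he _ _
  rw [hu _ (v2380_ne_sym2 (Or.inl hvp.symm) (Or.inl hxp.symm)),
    hu _ (v2380_ne_sym2 (Or.inr hxp.symm) (Or.inl hvx)),
    hu _ (v2380_ne_sym2 (Or.inl hvx.symm) (Or.inr hvp.symm)),
    hu _ (v2380_ne_sym2 (Or.inr hxq.symm) (Or.inl hvx)),
    hu _ (v2380_ne_sym2 (Or.inl hvx.symm) (Or.inr hvq.symm))] at hF1 hF2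
  have hN1 : (prodBernoulli (Function.update w s(v, x) 1)).real {ω | s(v, x) ∉ ω} = 0 := by
    rw [prodBernoulli_real_setOf_notMem, Function.update_self]; simp
  have hN0 : (prodBernoulli w).real {ω | s(v, x) ∈ ω} = 0 := by
    rw [prodBernoulli_real_setOf_mem, hw0]; rfl
  have hQ1 := v2380_le_of_null hN1 (v2380_I12 (v := v) (x := x) hpq cover).1
  have hQ2 := v2380_le_of_null hN1 (v2380_I12 (v := v) (x := x) hpq cover).2
  have hQ3 := v2380_le_of_null hN0 (v2380_I34 (v := v) (p := p) hxq cover).1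
  have hQ4 := v2380_le_of_null hN0 (v2380_I34 (v := v) (p := p) hxq cover).2
  rw [hF1] at hQ1; rw [hF2] at hQ2; rw [hF3] at hQ3; rw [hF4] at hQ4
  have hs1 := measureReal_inter_add_sdiff (μ := prodBernoulli (Function.update w s(v, x) 1))
    (s := openConn p q) (t := openConn v q) MeasurableSet.of_discrete
  have hs2 := measureReal_inter_add_sdiff (μ := prodBernoulli (Function.update w s(v, x) 1))
    (s := openConn v q) (t := openConn p q) MeasurableSet.of_discrete
  have hs3 := measureReal_inter_add_sdiff (μ := prodBernoulli w) (s := openConn p q) (t := openConn x q)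
    MeasurableSet.of_discrete
  have hs4 := measureReal_inter_add_sdiff (μ := prodBernoulli w) (s := openConn x q) (t := openConn p q)
    MeasurableSet.of_discrete
  rw [Set.inter_comm] at hs2 hs4
  set a : ℝ := (w s(v, p) : ℝ)
  set c : ℝ := (w s(v, q) : ℝ)
  set d : ℝ := (w s(x, p) : ℝ)
  set e : ℝ := (w s(x, q) : ℝ)
  set f : ℝ := (w s(p, q) : ℝ)
  have hF : (1 - d) * ((1 - e) * (1 - (1 - f) * (1 - a * c))) ≤ e * ((1 - d) * ((1 - f) * (1 - a * c))) := by
    linarith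
  have h1 : 0 ≤ (1 - a) * (e * ((1 - d) * ((1 - f) * (1 - a * c))) -
      (1 - d) * ((1 - e) * (1 - (1 - f) * (1 - a * c)))) :=
    mul_nonneg (sub_nonneg.2 (unitInterval.le_one _)) (sub_nonneg.2 hF)
  have h2 : 0 ≤ (1 - a) * (1 - d) * ((1 - f) * a * c + (1 - e) * c) :=
    mul_nonneg (mul_nonneg (sub_nonneg.2 (unitInterval.le_one _)) (sub_nonneg.2 (unitInterval.le_one _)))
      (add_nonneg (mul_nonneg (mul_nonneg (sub_nonneg.2 (unitInterval.le_one _)) (unitInterval.nonneg _))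
        (unitInterval.nonneg _)) (mul_nonneg (sub_nonneg.2 (unitInterval.le_one _)) (unitInterval.nonneg _)))
  linarith

/-- TTRL-lite variant V2380 (`n ≤ 4`) of the shortening step of stmt-CriticalPhenomena-4574
(Kozma–Nitzan Conjecture 6 with the induction hypothesis displayed, on at most four vertices).
After the trivial positions of the target `b` (`b = v`, `b = x`) and of the old minimiser `a₀`
(`a₀ = b`: every relay is a.s. joined to `b`; `a₀ = x`: the glued pair), four distinct vertices
`v, x, a₀, b` exhaust `Fin n`; if `x ∉ A` the claim is Harris' inequality for the glued measure,
and if `x ∈ A` the minimality `P_w(a₀ ↔ b) ≤ P_w(x ↔ b)` is converted, through explicit cylinder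
events on the five free pairs, into `P(a₀ ↔ b) ≤ P(v ↔ b)` after gluing (`v2380_hard`).  The
induction hypothesis is not used. -/
theorem stub_shorteningStep_var2380 :
    ∀ (n : ℕ) (w : Sym2 (Fin n) → unitInterval) (A : Finset (Fin n)) (b v x a₀ : Fin n), n ≤ 4 →
      v ∉ A → v ≠ x → w s(v, x) = 0 → a₀ ∈ A →
      (∀ a ∈ A, (prodBernoulli w).real (openConn a₀ b) ≤ (prodBernoulli w).real (openConn a b)) →
      (∀ w' : Sym2 (Fin n) → unitInterval, (∀ e, w e = 0 → w' e = 0) →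
        ∀ (A' : Finset (Fin n)) (o' b' : Fin n) (t : ℝ),
          (∀ a ∈ A', t ≤ (prodBernoulli w').real (openConn a b')) →
          (prodBernoulli w').real (⋃ a ∈ A', openConn o' a) * t ≤
            (prodBernoulli w').real (openConn o' b')) →
      (prodBernoulli (Function.update w s(v, x) 1)).real (⋃ a ∈ A, openConn v a) *
          (prodBernoulli (Function.update w s(v, x) 1)).real (openConn a₀ b) ≤
        (prodBernoulli (Function.update w s(v, x) 1)).real (openConn v b) := by
  intro n w A b v x a₀ hn hvA hvx hw0 ha₀ hmin _
  set μ := prodBernoulli (Function.update w s(v, x) 1) with hμ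
  have hN1 : μ.real {ω | s(v, x) ∉ ω} = 0 := by
    rw [hμ, prodBernoulli_real_setOf_notMem, Function.update_self]; simp
  -- the glued pair is a.s. open, so `x ↔ y` forces `v ↔ y`
  have hxb : ∀ y : Fin n, μ.real (openConn x y) ≤ μ.real (openConn v y) := fun y =>
    v2380_le_of_null hN1 fun ω hω => (em (s(v, x) ∈ ω)).elim
      (fun h => Or.inl ((v2380_reach_of_mem h).trans hω)) fun h => Or.inr h
  have U0 : 0 ≤ μ.real (⋃ a ∈ A, openConn v a) := measureReal_nonneg
  have U1 : μ.real (⋃ a ∈ A, openConn v a) ≤ 1 := measureReal_le_one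
  have Z0 : 0 ≤ μ.real (openConn a₀ b) := measureReal_nonneg
  have Z1 : μ.real (openConn a₀ b) ≤ 1 := measureReal_le_one
  by_cases hbv : b = v
  · rw [hbv] at Z0 ⊢
    rw [v2380_openConn_self, probReal_univ]
    exact v2380_mul_le_of_right U1 Z0 measureReal_le_one
  by_cases hbx : b = x
  · rw [hbx] at Z0 ⊢
    have h1 : μ.real (openConn x x) ≤ μ.real (openConn v x) := hxb x
    rw [v2380_openConn_self, probReal_univ] at h1
    exact v2380_mul_le_of_right U1 Z0 (measureReal_le_one.trans h1)
  by_cases hab : a₀ = b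
  · rw [hab] at Z1 ⊢
    -- every relay is a.s. joined to `b = a₀` before, hence after, gluing
    have hzero : ∀ a ∈ A, μ.real (openConn a b)ᶜ = 0 := by
      intro a ha
      have h2 := hmin a ha
      rw [hab, v2380_openConn_self, probReal_univ] at h2
      have h3 : (prodBernoulli w).real (openConn a b) ≤ μ.real (openConn a b) :=
        prodBernoulli_real_mono_of_isUpperSet (v2380_le_update w _) (isUpperSet_openConn a b)
          MeasurableSet.of_discrete
      have h4 : μ.real (openConn a b) ≤ 1 := measureReal_le_one
      rw [hμ, v2380_compl]; linarith
    have hN : μ.real (⋃ a ∈ A, (openConn a b)ᶜ) = 0 := le_antisymm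
      ((measureReal_biUnion_finset_le A _).trans (le_of_eq (Finset.sum_eq_zero hzero))) measureReal_nonneg
    refine v2380_mul_le_of_left U0 Z1 (v2380_le_of_null hN fun ω hω => ?_)
    obtain ⟨a, ha, hva⟩ := Set.mem_iUnion₂.1 hω
    by_cases hab' : ω ∈ openConn a b
    · exact Or.inl ((hva : (openGraph ω).Reachable v a).trans hab')
    · exact Or.inr (Set.mem_iUnion₂.2 ⟨a, ha, hab'⟩)
  by_cases hax : a₀ = x
  · rw [hax] at Z0 ⊢
    exact v2380_mul_le_of_right U1 Z0 (hxb b)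
  -- generic position: `v, x, a₀, b` are four distinct vertices exhausting `Fin n`
  have hvp : v ≠ a₀ := fun h => hvA (h ▸ ha₀)
  have hvq : v ≠ b := fun h => hbv h.symm
  have hxp : x ≠ a₀ := fun h => hax h.symm
  have hxq : x ≠ b := fun h => hbx h.symm
  have cover := v2380_cover hn hvx hvp hvq hxp hxq hab
  by_cases hxA : x ∈ A
  · exact v2380_mul_le_of_right U1 Z0 (v2380_hard w hvx hvp hvq hxp hxq hab cover hw0 (hmin x hxA))
  -- `x ∉ A`: then `A ⊆ {a₀, b}` and the claim is Harris' inequality for the glued measure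
  have hsub : (⋃ a ∈ A, openConn v a : Set (Set (Sym2 (Fin n)))) ⊆ openConn v a₀ ∪ openConn v b := by
    intro ω hω
    obtain ⟨a, ha, hva⟩ := Set.mem_iUnion₂.1 hω
    rcases cover a with rfl | rfl | rfl | rfl
    · exact absurd ha hvA
    · exact absurd ha hxA
    · exact Or.inl hva
    · exact Or.inr hva
  have harris := prodBernoulli_harris (Function.update w s(v, x) 1)
    ((isUpperSet_openConn v a₀).union (isUpperSet_openConn v b)) (isUpperSet_openConn a₀ b)
    MeasurableSet.of_discrete MeasurableSet.of_discrete
  have hinc : ((openConn v a₀ ∪ openConn v b) ∩ openConn a₀ b : Set (Set (Sym2 (Fin n)))) ⊆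
      openConn v b := by
    rintro ω ⟨h1 | h1, h2⟩
    · exact (h1 : (openGraph ω).Reachable v a₀).trans h2
    · exact h1
  calc μ.real (⋃ a ∈ A, openConn v a) * μ.real (openConn a₀ b)
      ≤ μ.real (openConn v a₀ ∪ openConn v b) * μ.real (openConn a₀ b) :=
        mul_le_mul_of_nonneg_right (measureReal_mono hsub) Z0
    _ ≤ μ.real ((openConn v a₀ ∪ openConn v b) ∩ openConn a₀ b) := harris
    _ ≤ μ.real (openConn v b) := measureReal_mono hinc

end Summit.CriticalPhenomena.PercolationContinuityZ3.Theorems
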